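import Literature.MathematicalPhysics.QuantumLattice.ApproximateEigenvectorLemmas
import HarnessLib

/-!
# One-point witness, part 1: the orthogonality table and the double-commutator identity

HONEST FRAMING: first certified bounds on pairing observables; not a superconductivity verdict;
every number certified (two lineages + referee) or labelled float. Crew hubbard-obs (D-0042), seat
hubbard-obs-p1 (`prover-hubbard-obs-p1-g4-0`). Pure finite-dimensional linear algebra over
`Matrix n n ℂ` / `n → ℂ` (the tree's `Fock`/`expect` format); zero compute; no definition, no named
fact, no `sorry`. Consumed by `PairLROOnePointWitness.lean` (the Horsch–von der Linden /
Kaplan–Horsch–von der Linden superposition and the one-point ⇒ LRO reduction).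

Data: a Hermitian conserved charge `Nop`, an operator `P` of charge `-q ≠ 0` (`Nop P − P Nop = −q P`),
a `Nop`-eigenvector `ψ` (eigenvalue `N`), `O = P + Pᴴ`, `w = Oψ`. Content:

* bookkeeping: Hermitian adjoints across `star _ ⬝ᵥ _`, orthogonality of eigenvectors with distinct
  eigenvalues, the charge ladder `Nop (P v) = (c − q) P v`, `Nop (Pᴴ v) = (c + q) Pᴴ v`, and the
  quadratic-form expansion of `⟨s(u + t w), X s(u + t w)⟩`;
* `onePointWitness_table`: `⟨ψ, w⟩ = 0`, `‖w‖² = ⟨ψ,PᴴPψ⟩ + ⟨ψ,PPᴴψ⟩`, `⟨w, O w⟩ = 0`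
  ("`⟨O⟩ = ⟨O³⟩ = 0` in a number eigenstate"), `⟨w, Nop w⟩ = N‖w‖² + q(⟨ψ,PPᴴψ⟩ − ⟨ψ,PᴴPψ⟩)`;
* `eucNorm_sq_add_conjTranspose_mulVec`: `‖Oψ‖₂² = Re⟨ψ,PᴴPψ⟩ + Re⟨ψ,PPᴴψ⟩` (the LRO amplitude);
* `dotProduct_doubleCommutator`: `⟨ψ, [O,[H,O]] ψ⟩ = 2(⟨w,Hw⟩ − E‖w‖²)` for `Hψ = Eψ`
  (Koma–Tasaki 1994, proof of Theorem 2.2).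

References: T. Koma, H. Tasaki, J. Stat. Phys. 76 (1994) 745, §2.2–2.3; T. A. Kaplan, P. Horsch,
W. von der Linden, J. Phys. Soc. Jpn. 58 (1989) 3894.
-/

noncomputable section

open Matrix Complex
open scoped ComplexOrder ComplexConjugate

namespace Summit.Ventures.CertifiedManyBodySolver.Observables

open Literature.MathematicalPhysics.QuantumLattice

section Abstract

variable {n : Type*} [Fintype n]

/-! ### Elementary adjoint / eigenvector bookkeeping -/

/-- `⟨A u, v⟩ = ⟨u, A v⟩` for Hermitian `A` (the general adjoint rule `⟨Au, v⟩ = ⟨u, Aᴴv⟩` is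
`rw [star_mulVec, ← dotProduct_mulVec]`). [folklore] -/
theorem star_mulVec_dotProduct_of_isHermitian {A : Matrix n n ℂ} (hA : A.IsHermitian)
    (u v : n → ℂ) : star (A *ᵥ u) ⬝ᵥ v = star u ⬝ᵥ (A *ᵥ v) := by
  rw [star_mulVec, hA.eq, ← dotProduct_mulVec]

/-- Eigenvectors of a Hermitian matrix with distinct real eigenvalues are orthogonal. [folklore] -/
theorem dotProduct_eq_zero_of_eigen_ne {A : Matrix n n ℂ} (hA : A.IsHermitian) {u v : n → ℂ}
    {a b : ℝ} (hu : A *ᵥ u = (a : ℂ) • u) (hv : A *ᵥ v = (b : ℂ) • v) (hab : a ≠ b) :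
    star u ⬝ᵥ v = 0 := by
  have h1 : star (A *ᵥ u) ⬝ᵥ v = star u ⬝ᵥ (A *ᵥ v) := star_mulVec_dotProduct_of_isHermitian hA u v
  rw [hu, hv, star_smul, smul_dotProduct, dotProduct_smul, Complex.star_def, Complex.conj_ofReal,
    smul_eq_mul, smul_eq_mul] at h1
  have h2 : ((a : ℂ) - b) * (star u ⬝ᵥ v) = 0 := by rw [sub_mul, h1, sub_self]
  rcases mul_eq_zero.1 h2 with h | h
  · exact absurd (by exact_mod_cast sub_eq_zero.1 h) hab
  · exact h

/-- Charge ladder: `[A, P] = k P` and `A v = c v` give `A (P v) = (c + k) P v`. [folklore] -/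
theorem mulVec_mulVec_eigen_of_commutator {A P : Matrix n n ℂ} {k : ℝ}
    (hAP : A * P - P * A = (k : ℂ) • P) {v : n → ℂ} {c : ℝ} (hv : A *ᵥ v = (c : ℂ) • v) :
    A *ᵥ (P *ᵥ v) = ((c + k : ℝ) : ℂ) • (P *ᵥ v) := by
  have h1 : A * P = (k : ℂ) • P + P * A := sub_eq_iff_eq_add.1 hAP
  rw [mulVec_mulVec, h1, add_mulVec, smul_mulVec, ← mulVec_mulVec, hv, mulVec_smul,
    ← add_smul, add_comm, Complex.ofReal_add]

/-- A neutral operator preserves the charge: `X A = A X` and `A v = c v` give `A (X v) = c (X v)`.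
[folklore] -/
theorem mulVec_mulVec_eigen_of_commute {A X : Matrix n n ℂ} (hXA : X * A = A * X) {v : n → ℂ}
    {c : ℂ} (hv : A *ᵥ v = c • v) : A *ᵥ (X *ᵥ v) = c • (X *ᵥ v) := by
  rw [mulVec_mulVec, ← hXA, ← mulVec_mulVec, hv, mulVec_smul]

/-- The adjoint has the opposite charge: `[A, P] = k P` with `A` Hermitian and `k` real gives
`[A, Pᴴ] = -k Pᴴ`. [folklore] -/
theorem commutator_conjTranspose_of_commutator {A P : Matrix n n ℂ} (hA : A.IsHermitian) {k : ℝ}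
    (hAP : A * P - P * A = (k : ℂ) • P) :
    A * Pᴴ - Pᴴ * A = ((-k : ℝ) : ℂ) • Pᴴ := by
  have h := congrArg conjTranspose hAP
  rw [conjTranspose_sub, conjTranspose_mul, conjTranspose_mul, hA.eq, conjTranspose_smul,
    Complex.star_def, Complex.conj_ofReal] at h
  -- h : Pᴴ * A - A * Pᴴ = ↑k • Pᴴ
  rw [← neg_sub, h, Complex.ofReal_neg, neg_smul]

/-- Quadratic-form expansion of `⟨s(u + t w), X s(u + t w)⟩` for real `s, t`. [folklore] -/
theorem dotProduct_mulVec_smul_add (X : Matrix n n ℂ) (u w : n → ℂ) (s t : ℝ) :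
    star ((s : ℂ) • (u + (t : ℂ) • w)) ⬝ᵥ (X *ᵥ ((s : ℂ) • (u + (t : ℂ) • w))) =
      (s : ℂ) ^ 2 * (star u ⬝ᵥ (X *ᵥ u) + (t : ℂ) * (star u ⬝ᵥ (X *ᵥ w) + star w ⬝ᵥ (X *ᵥ u)) +
        (t : ℂ) ^ 2 * (star w ⬝ᵥ (X *ᵥ w))) := by
  simp only [mulVec_smul, mulVec_add, star_smul, star_add, smul_dotProduct, dotProduct_smul,
    add_dotProduct, dotProduct_add, Complex.star_def, Complex.conj_ofReal, smul_eq_mul]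
  ring

/-- Expansion of `⟨s(u + t w), s(u + t w)⟩` for real `s, t`. [folklore] -/
theorem dotProduct_smul_add_self (u w : n → ℂ) (s t : ℝ) :
    star ((s : ℂ) • (u + (t : ℂ) • w)) ⬝ᵥ ((s : ℂ) • (u + (t : ℂ) • w)) =
      (s : ℂ) ^ 2 * (star u ⬝ᵥ u + (t : ℂ) * (star u ⬝ᵥ w + star w ⬝ᵥ u) +
        (t : ℂ) ^ 2 * (star w ⬝ᵥ w)) := by
  simp only [star_smul, star_add, smul_dotProduct, dotProduct_smul, add_dotProduct, dotProduct_add,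
    Complex.star_def, Complex.conj_ofReal, smul_eq_mul]
  ring

/-! ### The witness -/

/-- Charges of `Pψ` and `Pᴴψ`: `Nop (Pψ) = (N − q) Pψ`, `Nop (Pᴴψ) = (N + q) Pᴴψ` for a
`Nop`-eigenvector `ψ` (eigenvalue `N`) and `P` of charge `-q`. [cite: KomaTasaki1994, §2.3 (2.16)] -/
theorem onePointWitness_eigen {Nop P : Matrix n n ℂ} (hNop : Nop.IsHermitian) {q N : ℝ}
    (hNP : Nop * P - P * Nop = ((-q : ℝ) : ℂ) • P) {ψ : n → ℂ} (hNψ : Nop *ᵥ ψ = (N : ℂ) • ψ) :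
    Nop * Pᴴ - Pᴴ * Nop = ((q : ℝ) : ℂ) • Pᴴ ∧
    Nop *ᵥ (P *ᵥ ψ) = ((N + -q : ℝ) : ℂ) • (P *ᵥ ψ) ∧
    Nop *ᵥ (Pᴴ *ᵥ ψ) = ((N + q : ℝ) : ℂ) • (Pᴴ *ᵥ ψ) := by
  have hNPd : Nop * Pᴴ - Pᴴ * Nop = ((- -q : ℝ) : ℂ) • Pᴴ :=
    commutator_conjTranspose_of_commutator hNop hNP
  rw [neg_neg] at hNPd
  exact ⟨hNPd, mulVec_mulVec_eigen_of_commutator hNP hNψ, mulVec_mulVec_eigen_of_commutator hNPd hNψ⟩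

/-- The orthogonality table behind the Horsch–von der Linden / KHvdL computation: for a `Nop`-eigenvector
`ψ` (eigenvalue `N`) and `P` of charge `-q ≠ 0`, with `w = (P + Pᴴ)ψ`:
`⟨ψ, w⟩ = 0`, `‖w‖² = ⟨ψ,PᴴPψ⟩ + ⟨ψ,PPᴴψ⟩`, `⟨w, (P + Pᴴ) w⟩ = 0` ("`⟨O⟩ = ⟨O³⟩ = 0` in a number
eigenstate") and `⟨w, Nop w⟩ = N‖w‖² + q(⟨ψ,PPᴴψ⟩ − ⟨ψ,PᴴPψ⟩)`.
[cite: KomaTasaki1994, §2.2 (2.6)–(2.8)] -/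
theorem onePointWitness_table {Nop P : Matrix n n ℂ} (hNop : Nop.IsHermitian) {q N : ℝ}
    (hNP : Nop * P - P * Nop = ((-q : ℝ) : ℂ) • P) (hq : q ≠ 0) {ψ : n → ℂ}
    (hNψ : Nop *ᵥ ψ = (N : ℂ) • ψ) :
    star ψ ⬝ᵥ ((P + Pᴴ) *ᵥ ψ) = 0 ∧
    star ((P + Pᴴ) *ᵥ ψ) ⬝ᵥ ((P + Pᴴ) *ᵥ ψ) =
      star ψ ⬝ᵥ ((Pᴴ * P) *ᵥ ψ) + star ψ ⬝ᵥ ((P * Pᴴ) *ᵥ ψ) ∧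
    star ((P + Pᴴ) *ᵥ ψ) ⬝ᵥ ((P + Pᴴ) *ᵥ ((P + Pᴴ) *ᵥ ψ)) = 0 ∧
    star ((P + Pᴴ) *ᵥ ψ) ⬝ᵥ (Nop *ᵥ ((P + Pᴴ) *ᵥ ψ)) =
      (N : ℂ) * (star ψ ⬝ᵥ ((Pᴴ * P) *ᵥ ψ) + star ψ ⬝ᵥ ((P * Pᴴ) *ᵥ ψ)) +
        (q : ℂ) * (star ψ ⬝ᵥ ((P * Pᴴ) *ᵥ ψ) - star ψ ⬝ᵥ ((Pᴴ * P) *ᵥ ψ)) := by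
  -- charges of the eight vectors involved
  obtain ⟨hNPd, e1, e2⟩ := onePointWitness_eigen hNop hNP hNψ
  have e11 : Nop *ᵥ (P *ᵥ (P *ᵥ ψ)) = ((N + -q + -q : ℝ) : ℂ) • (P *ᵥ (P *ᵥ ψ)) :=
    mulVec_mulVec_eigen_of_commutator hNP e1
  have e21 : Nop *ᵥ (Pᴴ *ᵥ (P *ᵥ ψ)) = ((N + -q + q : ℝ) : ℂ) • (Pᴴ *ᵥ (P *ᵥ ψ)) :=
    mulVec_mulVec_eigen_of_commutator hNPd e1
  have e12 : Nop *ᵥ (P *ᵥ (Pᴴ *ᵥ ψ)) = ((N + q + -q : ℝ) : ℂ) • (P *ᵥ (Pᴴ *ᵥ ψ)) :=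
    mulVec_mulVec_eigen_of_commutator hNP e2
  have e22 : Nop *ᵥ (Pᴴ *ᵥ (Pᴴ *ᵥ ψ)) = ((N + q + q : ℝ) : ℂ) • (Pᴴ *ᵥ (Pᴴ *ᵥ ψ)) :=
    mulVec_mulVec_eigen_of_commutator hNPd e2
  -- orthogonalities
  have o1 : star ψ ⬝ᵥ (P *ᵥ ψ) = 0 :=
    dotProduct_eq_zero_of_eigen_ne hNop hNψ e1 (by intro h; apply hq; linarith)
  have o2 : star ψ ⬝ᵥ (Pᴴ *ᵥ ψ) = 0 :=
    dotProduct_eq_zero_of_eigen_ne hNop hNψ e2 (by intro h; apply hq; linarith)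
  have o3 : star (P *ᵥ ψ) ⬝ᵥ (Pᴴ *ᵥ ψ) = 0 :=
    dotProduct_eq_zero_of_eigen_ne hNop e1 e2 (by intro h; apply hq; linarith)
  have o4 : star (Pᴴ *ᵥ ψ) ⬝ᵥ (P *ᵥ ψ) = 0 :=
    dotProduct_eq_zero_of_eigen_ne hNop e2 e1 (by intro h; apply hq; linarith)
  have o5 : star (P *ᵥ ψ) ⬝ᵥ (P *ᵥ (P *ᵥ ψ)) = 0 :=
    dotProduct_eq_zero_of_eigen_ne hNop e1 e11 (by intro h; apply hq; linarith)
  have o6 : star (P *ᵥ ψ) ⬝ᵥ (Pᴴ *ᵥ (P *ᵥ ψ)) = 0 :=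
    dotProduct_eq_zero_of_eigen_ne hNop e1 e21 (by intro h; apply hq; linarith)
  have o7 : star (P *ᵥ ψ) ⬝ᵥ (P *ᵥ (Pᴴ *ᵥ ψ)) = 0 :=
    dotProduct_eq_zero_of_eigen_ne hNop e1 e12 (by intro h; apply hq; linarith)
  have o8 : star (P *ᵥ ψ) ⬝ᵥ (Pᴴ *ᵥ (Pᴴ *ᵥ ψ)) = 0 :=
    dotProduct_eq_zero_of_eigen_ne hNop e1 e22 (by intro h; apply hq; linarith)
  have o9 : star (Pᴴ *ᵥ ψ) ⬝ᵥ (P *ᵥ (P *ᵥ ψ)) = 0 :=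
    dotProduct_eq_zero_of_eigen_ne hNop e2 e11 (by intro h; apply hq; linarith)
  have o10 : star (Pᴴ *ᵥ ψ) ⬝ᵥ (Pᴴ *ᵥ (P *ᵥ ψ)) = 0 :=
    dotProduct_eq_zero_of_eigen_ne hNop e2 e21 (by intro h; apply hq; linarith)
  have o11 : star (Pᴴ *ᵥ ψ) ⬝ᵥ (P *ᵥ (Pᴴ *ᵥ ψ)) = 0 :=
    dotProduct_eq_zero_of_eigen_ne hNop e2 e12 (by intro h; apply hq; linarith)
  have o12 : star (Pᴴ *ᵥ ψ) ⬝ᵥ (Pᴴ *ᵥ (Pᴴ *ᵥ ψ)) = 0 :=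
    dotProduct_eq_zero_of_eigen_ne hNop e2 e22 (by intro h; apply hq; linarith)
  -- the two diagonal norms as expectations
  have d1 : star (P *ᵥ ψ) ⬝ᵥ (P *ᵥ ψ) = star ψ ⬝ᵥ ((Pᴴ * P) *ᵥ ψ) := by
    rw [star_mulVec, ← dotProduct_mulVec, mulVec_mulVec]
  have d2 : star (Pᴴ *ᵥ ψ) ⬝ᵥ (Pᴴ *ᵥ ψ) = star ψ ⬝ᵥ ((P * Pᴴ) *ᵥ ψ) := by
    rw [star_mulVec, ← dotProduct_mulVec, conjTranspose_conjTranspose, mulVec_mulVec]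
  refine ⟨?_, ?_, ?_, ?_⟩
  · rw [add_mulVec, dotProduct_add, o1, o2, add_zero]
  · rw [add_mulVec, star_add, add_dotProduct, dotProduct_add, dotProduct_add, o3, o4, d1, d2]
    ring
  · simp only [add_mulVec, mulVec_add, star_add, add_dotProduct, dotProduct_add, o5, o6, o7, o8,
      o9, o10, o11, o12, add_zero]
  · rw [add_mulVec, mulVec_add, e1, e2, star_add, add_dotProduct, dotProduct_add, dotProduct_add,
      dotProduct_smul, dotProduct_smul, dotProduct_smul, dotProduct_smul, o3, o4, d1, d2]
    simp only [smul_eq_mul, mul_zero, add_zero, zero_add]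
    push_cast
    ring

/-- `‖(P + Pᴴ)ψ‖₂² = Re⟨ψ, PᴴP ψ⟩ + Re⟨ψ, PPᴴ ψ⟩` for a `Nop`-eigenvector `ψ` and `P` of charge
`-q ≠ 0`: the LRO amplitude seen by the witness. [cite: KomaTasaki1994, §2.2 (2.7)–(2.8)] -/
theorem eucNorm_sq_add_conjTranspose_mulVec {Nop P : Matrix n n ℂ} (hNop : Nop.IsHermitian)
    {q N : ℝ} (hNP : Nop * P - P * Nop = ((-q : ℝ) : ℂ) • P) (hq : q ≠ 0) {ψ : n → ℂ}
    (hNψ : Nop *ᵥ ψ = (N : ℂ) • ψ) :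
    eucNorm ((P + Pᴴ) *ᵥ ψ) ^ 2 =
      (star ψ ⬝ᵥ ((Pᴴ * P) *ᵥ ψ)).re + (star ψ ⬝ᵥ ((P * Pᴴ) *ᵥ ψ)).re := by
  rw [eucNorm_sq, (onePointWitness_table hNop hNP hq hNψ).2.1, Complex.add_re]

/-- **The double-commutator identity of Horsch–von der Linden** (KT 1994, proof of Theorem 2.2):
for `H` Hermitian with `Hψ = Eψ` and `O` Hermitian, with `w = Oψ`,
`⟨ψ, [O,[H,O]] ψ⟩ = 2(⟨w, Hw⟩ − E⟨w, w⟩)`. [cite: KomaTasaki1994, Theorem 2.2 proof] -/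
theorem dotProduct_doubleCommutator {H O : Matrix n n ℂ} (hH : H.IsHermitian) (hO : O.IsHermitian)
    {ψ : n → ℂ} {E : ℝ} (hHψ : H *ᵥ ψ = (E : ℂ) • ψ) :
    star ψ ⬝ᵥ ((O * (H * O - O * H) - (H * O - O * H) * O) *ᵥ ψ) =
      2 * (star (O *ᵥ ψ) ⬝ᵥ (H *ᵥ (O *ᵥ ψ)) - (E : ℂ) * (star (O *ᵥ ψ) ⬝ᵥ (O *ᵥ ψ))) := by
  have h1 : star ψ ⬝ᵥ ((O * H * O) *ᵥ ψ) = star (O *ᵥ ψ) ⬝ᵥ (H *ᵥ (O *ᵥ ψ)) := by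
    rw [star_mulVec_dotProduct_of_isHermitian hO, mulVec_mulVec, mulVec_mulVec, Matrix.mul_assoc]
  have h2 : star ψ ⬝ᵥ ((O * O * H) *ᵥ ψ) = (E : ℂ) * (star (O *ᵥ ψ) ⬝ᵥ (O *ᵥ ψ)) := by
    rw [← mulVec_mulVec, hHψ, mulVec_smul, dotProduct_smul, ← mulVec_mulVec,
      ← star_mulVec_dotProduct_of_isHermitian hO, smul_eq_mul]
  have h3 : star ψ ⬝ᵥ ((H * O * O) *ᵥ ψ) = (E : ℂ) * (star (O *ᵥ ψ) ⬝ᵥ (O *ᵥ ψ)) := by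
    rw [Matrix.mul_assoc, ← mulVec_mulVec, ← star_mulVec_dotProduct_of_isHermitian hH, hHψ,
      star_smul, smul_dotProduct, Complex.star_def, Complex.conj_ofReal, smul_eq_mul,
      ← mulVec_mulVec, ← star_mulVec_dotProduct_of_isHermitian hO]
  have halg : O * (H * O - O * H) - (H * O - O * H) * O =
      O * H * O + O * H * O - O * O * H - H * O * O := by
    simp only [Matrix.mul_sub, Matrix.sub_mul, Matrix.mul_assoc]; abel
  rw [halg, sub_mulVec, sub_mulVec, add_mulVec, dotProduct_sub, dotProduct_sub, dotProduct_add, h1,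
    h2, h3]
  ring

end Abstract

end Summit.Ventures.CertifiedManyBodySolver.Observables

end
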